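import Literature.Analysis.Complex.AsymptoticValues
import Literature.Probability.RandomPlanarGeometry.CaratheodoryHalfPlane
import Literature.Probability.RandomPlanarGeometry.HalfPlaneFill
import Literature.Probability.RandomPlanarGeometry.LoewnerMapProofs
import Literature.Probability.RandomPlanarGeometry.LoewnerTraceLimit
import Literature.Probability.RandomPlanarGeometry.SLETraceCriterion
import Literature.Probability.RandomPlanarGeometry.SLETraceMeasurable
import HarnessLib

/-!
# Rohde–Schramm's Theorem 4.1 (the deterministic trace criterion), proved

Trunk T-STOCH. Discharge of the named fact `Literature.Probability.RandomPlanarGeometry.RohdeSchramm2005_thm41`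
(`Literature/Probability/RandomPlanarGeometry/SLETraceCriterion.lean`; Rohde–Schramm, *Basic
properties of SLE*, Ann. Math. 161 (2005), Thm. 4.1, p. 898): for a continuous driving function
`ξ`, if `β(t) := lim_{y↓0} gₜ⁻¹(ξ(t) + iy)` exists for every `t` and is continuous in `t`, then
for every `t` the Loewner domain `Hₜ` is the unbounded component of `ℍ ∖ β[0, t]`
(`Literature.Probability.RandomPlanarGeometry.RohdeSchramm2005_thm41_holds`). Consequently the Rohde–Schramm trace theorem
`Literature.Probability.RandomPlanarGeometry.hasSLETrace_of_ne_eight` (Thm. 5.1) rests on the stochastic estimate Thm. 3.6 alone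
(`Literature.Probability.RandomPlanarGeometry.hasSLETrace_of_ne_eight_of_thm36`), `SLE₀` is generated by a curve unconditionally
(`Literature.Probability.RandomPlanarGeometry.hasSLETrace_zero`), and `Literature.Probability.RandomPlanarGeometry.exists_isSLECurve` follows from
{[LSW04] Thm. 4.7 (`κ = 8`), [RS05] Thm. 3.6, [RS05] Thm. 7.1} (`Literature.Probability.RandomPlanarGeometry.exists_isSLECurve_of_thm36`).

## The proof

We follow the structure of Lawler, *Conformally Invariant Processes in the Plane* (2005),
Prop. 4.27 and Prop. 4.29 (accessible points), replacing Lawler's half-plane-capacity estimate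
(3.21) (a Beurling estimate) by the elementary backward-in-time argument suggested by
Rohde–Schramm's own proof (p. 899: "Because `g_τ(p')` has to hit the singularity `ξ(τ)` at some
time `τ ≤ t'` ..."), and [Ahl73, Th. 3.5] / Lawler's Prop. 3.86 by the length–area form of the
Lindelöf–Koebe uniqueness of asymptotic values (`Literature.Analysis.Complex.LengthArea.eq_of_tendsto_of_tendsto`,
`Literature/Analysis/Complex/AsymptoticValues.lean`).

1. *Backward stability* (`IsSolution.le_norm_sub_driving_of_end`): if a solution of the Loewner
   equation is at distance `≥ 2θ` from the driving function at time `s`, it was at distance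
   `≥ θ` during `[s - τ, s]`, with `τ` depending only on `θ` and the modulus of continuity of
   `ξ` (`|ġ| = 2/|g - ξ| ≤ 2/θ` while the distance is `≥ θ`; a last-exit argument).
2. *Accessible points are reached through `ξ(s)`* (`tendsto_map_of_accessible`; Lawler (2005),
   proof of Prop. 4.27, "`lim_{r→0+} gₜ(η(r)) = lim_{s→t-} gₛ(z) = Uₜ`"): if `z ∈ ℍ` is swallowed
   exactly at time `s` and the segment `(z, p]` lies in `Hₛ`, then `gₛ(z + r(p - z)) → ξ(s)` as
   `r ↓ 0`. Otherwise, by 1. and the continuity of `g_u` at `z` for `u < s`, the maximal solution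
   from `z` would stay `θ`-away from `ξ` on `[s - τ, s)`, contradicting `inf_{u<s}|g_u(z) - ξ(u)|
   = 0` (`IsSolution.exists_norm_sub_lt`).
3. *Accessible points are on the curve* (`eq_of_accessible`; Rohde–Schramm p. 899, "`β(t') = p'`
   follows because the conformal map `g_{t'}⁻¹` of `ℍ` cannot have two different limits along
   two arcs with the same terminal point"): `fₛ = gₛ⁻¹` tends to `β(s)` along the vertical
   segment at `ξ(s)` (hypothesis) and to `z` along the arc `gₛ((z, p])` ending at `ξ(s)` (by 2.),
   so `z = β(s)` (`eq_of_tendsto_of_tendsto_upperHalfPlane`, the half-plane form of the two-curves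
   lemma, via the Cayley transform and `w ↦ (w + i)⁻¹`).
4. *`∂Hₜ ∩ ℍ ⊆ β[0, t]`* (`frontier_domain_subset_image`; Lawler (2005), Prop. 4.27, second
   part): for `w ∈ ∂Hₜ ∩ ℍ` and `w' ∈ Hₜ` near `w`, the first point `z'` of the segment
   `[w', w]` outside `Hₜ` is accessible at time `T_{z'} ≤ t`, hence `z' = β(T_{z'})` by 3.
5. *Assembly* (`RohdeSchramm2005_thm41_holds`; Rohde–Schramm p. 899, last paragraph of the proof):
   `Hₜ` is connected (`= fₜ(ℍ)`), unbounded, disjoint from `β[0, t]` (`β(s) ∉ Hₛ ⊇ Hₜ`,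
   `notMem_domain_of_tendsto_invFunOn_map`) and relatively closed in `ℍ ∖ β[0, t]` by 4., hence
   equal to the unbounded component.

Everything used is proved in the tree (Loewner flow: `LoewnerChainProofs`, `LoewnerFlow`,
`LoewnerMapProofs`, `LoewnerGrowth`; topology of `ℍ ∖ S`: `HalfPlaneFill`; Wolff's lemma:
`LengthArea`); Mathlib has no Loewner chains.

## References

* S. Rohde, O. Schramm, *Basic properties of SLE*, Ann. of Math. 161 (2005), Thm. 4.1 and its
  proof (pp. 898–899), Thm. 5.1 (p. 899).
* G. F. Lawler, *Conformally Invariant Processes in the Plane*, AMS (2005), §4.4, Prop. 4.27,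
  Prop. 4.29.
* Ch. Pommerenke, *Boundary Behaviour of Conformal Maps* (1992), Cor. 2.17.
-/

noncomputable section

open Set Filter Topology Metric Complex MeasureTheory
open UpperHalfPlane (upperHalfPlaneSet isOpen_upperHalfPlaneSet)
open scoped NNReal

namespace Literature.Probability.RandomPlanarGeometry

namespace Loewner

variable {W : ℝ≥0 → ℝ} {z : ℂ} {g : ℝ → ℂ} {T : WithTop ℝ≥0}

/-! ### 1. Backward stability of the distance to the driving function -/

/-- **Backward stability.** Let `g` solve the Loewner equation on `[0, T)` with `s < T`,
`θ > 0`, and let `τ ∈ (0, s]` satisfy `τ ≤ θ² / 4` and be a `θ/4`-modulus of continuity of the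
driving function on `[0, s]`. If `|g(s) - W(s)| ≥ 2θ` then `|g(u) - W(u)| ≥ θ` for all
`u ∈ [s - τ, s]`: at the last time `u₁ ≤ s` with `|g - W| ≤ θ` one has `|ġ| ≤ 2/θ` on `[u₁, s]`,
so `|g(s) - W(s)| ≤ θ + 2τ/θ + θ/4 < 2θ`. (The quantitative content of "because `g_τ(p')` has
to hit the singularity `ξ(τ)` at some time `τ ≤ t'`" in Rohde–Schramm (2005), proof of
Thm. 4.1, p. 899.) [cite: RohdeSchramm2005, proof of Thm 4.1] -/
theorem IsSolution.le_norm_sub_driving_of_end (hW : Continuous W) (h : IsSolution W z g T)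
    {s θ τ : ℝ} (hθ : 0 < θ) (hτ : 0 < τ) (hτs : τ ≤ s) (hτθ : τ ≤ θ ^ 2 / 4)
    (hsT : (s.toNNReal : WithTop ℝ≥0) < T)
    (hmod : ∀ u ∈ Icc (0 : ℝ) s, ∀ v ∈ Icc (0 : ℝ) s, |u - v| ≤ τ →
      |W u.toNNReal - W v.toNNReal| ≤ θ / 4)
    (hend : 2 * θ ≤ ‖g s - W s.toNNReal‖) :
    ∀ u ∈ Icc (s - τ) s, θ ≤ ‖g u - W u.toNNReal‖ := by
  set F : ℝ → ℝ := fun u ↦ ‖g u - W u.toNNReal‖ with hF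
  have hs0 : 0 ≤ s - τ := by linarith
  have hdom : Icc (s - τ) s ⊆ {t : ℝ | 0 ≤ t ∧ (t.toNNReal : WithTop ℝ≥0) < T} := fun u hu ↦
    ⟨hs0.trans hu.1, lt_of_le_of_lt (WithTop.coe_le_coe.2 (Real.toNNReal_le_toNNReal hu.2)) hsT⟩
  have hFc : ContinuousOn F (Icc (s - τ) s) :=
    ((h.continuousOn.mono hdom).sub
      (Complex.continuous_ofReal.comp (hW.comp continuous_real_toNNReal)).continuousOn).norm
  by_contra hcon
  push Not at hcon
  obtain ⟨u₀, hu₀, hFu₀⟩ := hcon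
  -- the last time `u₁ ∈ [s - τ, s]` with `F u₁ ≤ θ`
  set A : Set ℝ := Icc (s - τ) s ∩ F ⁻¹' Iic θ with hA
  have hAc : IsClosed A := hFc.preimage_isClosed_of_isClosed isClosed_Icc isClosed_Iic
  have hu₀A : u₀ ∈ A := ⟨hu₀, hFu₀.le⟩
  have hAne : A.Nonempty := ⟨u₀, hu₀A⟩
  have hAbdd : BddAbove A := ⟨s, fun u hu ↦ hu.1.2⟩
  set u₁ := sSup A with hu₁
  have hu₁A : u₁ ∈ A := hAc.csSup_mem hAne hAbdd
  have hu₁s : u₁ ≤ s := hu₁A.1.2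
  have hu₁l : s - τ ≤ u₁ := hu₁A.1.1
  have hFs : 2 * θ ≤ F s := hend
  have hsA : s ∉ A := fun hs ↦ by
    have : F s ≤ θ := hs.2
    linarith
  have hu₁lt : u₁ < s := lt_of_le_of_ne hu₁s fun heq ↦ hsA (heq ▸ hu₁A)
  -- `θ < F v` on `(u₁, s]`
  have hgt : ∀ v ∈ Ioc u₁ s, θ < F v := fun v hv ↦ by
    by_contra hle
    push Not at hle
    have hvA : v ∈ A := ⟨⟨hu₁l.trans hv.1.le, hv.2⟩, hle⟩
    exact absurd (le_csSup hAbdd hvA) (not_le.2 hv.1)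
  -- hence `θ ≤ F u₁` (right continuity)
  have hge : θ ≤ F u₁ := by
    have hcw : ContinuousWithinAt F (Icc (s - τ) s) u₁ := hFc.continuousWithinAt hu₁A.1
    have hmem : Icc (s - τ) s ∈ 𝓝[>] u₁ :=
      mem_of_superset (Ioo_mem_nhdsGT hu₁lt) fun v hv ↦ ⟨hu₁l.trans hv.1.le, hv.2.le⟩
    have hcw' : ContinuousWithinAt F (Ioi u₁) u₁ := hcw.mono_of_mem_nhdsWithin hmem
    refine ge_of_tendsto hcw'.tendsto ?_
    filter_upwards [Ioo_mem_nhdsGT hu₁lt] with v hv using (hgt v ⟨hv.1, hv.2.le⟩).le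
  -- derivative bound `‖ġ‖ ≤ 2/θ` on `[u₁, s]`
  have hsub : Icc u₁ s ⊆ {t : ℝ | 0 ≤ t ∧ (t.toNNReal : WithTop ℝ≥0) < T} :=
    fun v hv ↦ hdom ⟨hu₁l.trans hv.1, hv.2⟩
  have hderiv : ∀ v ∈ Icc u₁ s, HasDerivWithinAt g (vectorField W v (g v)) (Icc u₁ s) v :=
    fun v hv ↦ (h.isIntegralCurveOn v (hsub hv)).mono hsub
  have hbound : ∀ v ∈ Ico u₁ s, ‖vectorField W v (g v)‖ ≤ 2 / θ := fun v hv ↦ by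
    have hFv : θ ≤ F v := by
      rcases eq_or_lt_of_le hv.1 with heq | hlt
      · rw [← heq]; exact hge
      · exact (hgt v ⟨hlt, hv.2.le⟩).le
    rw [vectorField_apply, norm_div]
    have h2 : ‖(2 : ℂ)‖ = 2 := by norm_num
    rw [h2]
    exact div_le_div_of_nonneg_left (by norm_num) hθ hFv
  have hmv := norm_image_sub_le_of_norm_deriv_le_segment' hderiv hbound s
    (right_mem_Icc.2 hu₁s)
  have h1 : ‖g s - g u₁‖ ≤ θ / 2 := by
    have hsu : s - u₁ ≤ τ := by linarith
    calc ‖g s - g u₁‖ ≤ 2 / θ * (s - u₁) := hmv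
      _ ≤ 2 / θ * τ := by gcongr
      _ ≤ 2 / θ * (θ ^ 2 / 4) := by gcongr
      _ = θ / 2 := by field_simp; ring
  have h2 : |W s.toNNReal - W u₁.toNNReal| ≤ θ / 4 :=
    hmod s ⟨by linarith, le_rfl⟩ u₁ ⟨hs0.trans hu₁l, hu₁s⟩
      (by rw [abs_of_nonneg (by linarith)]; linarith)
  -- triangle inequality: `F s ≤ F u₁ + ‖g s - g u₁‖ + |W s - W u₁| < 2θ`
  have h3 : F s ≤ F u₁ + ‖g s - g u₁‖ + |W s.toNNReal - W u₁.toNNReal| := by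
    have heq : g s - (W s.toNNReal : ℂ) =
        (g u₁ - W u₁.toNNReal) + (g s - g u₁) - ((W s.toNNReal : ℂ) - W u₁.toNNReal) := by ring
    calc F s = ‖(g u₁ - W u₁.toNNReal) + (g s - g u₁) - ((W s.toNNReal : ℂ) - W u₁.toNNReal)‖ := by
          simp only [hF]; rw [heq]
      _ ≤ ‖(g u₁ - W u₁.toNNReal) + (g s - g u₁)‖ + ‖(W s.toNNReal : ℂ) - W u₁.toNNReal‖ :=
          norm_sub_le _ _
      _ ≤ ‖g u₁ - (W u₁.toNNReal : ℂ)‖ + ‖g s - g u₁‖ + ‖(W s.toNNReal : ℂ) - W u₁.toNNReal‖ := by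
          gcongr; exact norm_add_le _ _
      _ = F u₁ + ‖g s - g u₁‖ + |W s.toNNReal - W u₁.toNNReal| := by
          rw [← Complex.ofReal_sub, Complex.norm_real, Real.norm_eq_abs]
  have hFu₁ : F u₁ ≤ θ := hu₁A.2
  linarith

/-! ### 2. Accessible points are reached through the driving point -/

/-- **Lawler (2005), proof of Prop. 4.27: `lim_{r→0+} gₛ(η(r)) = ξ(s)` for an `s`-accessible
point.** Let `W` be continuous, `z ∈ ℍₒ` with `T_z = s`, and suppose the half-open segment
`{z + r(p - z) : r ∈ (0, 1]}` lies in `Hₛ`. Then `gₛ(z + r(p - z)) → W(s)` as `r ↓ 0`. Proof: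
otherwise `|gₛ - W(s)| ≥ 2θ` at points of the segment arbitrarily close to `z`; by backward
stability (`IsSolution.le_norm_sub_driving_of_end`) their orbits are `θ`-away from `W` on
`[s - τ, s]`, and letting the points tend to `z` (continuity of `g_u` at `z` for `u < s`,
`continuousAt_map`) so is the orbit of `z` on `[s - τ, s)` — contradicting
`inf_{u<s} |g_u(z) - W(u)| = 0` (`IsSolution.exists_norm_sub_lt`). This replaces the capacity
estimate (3.21) of Lawler's proof. [cite: Lawler2005, Prop. 4.27] -/
theorem tendsto_map_of_accessible (hW : Continuous W) {z p : ℂ} {s : ℝ≥0} (hz : 0 < z.im)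
    (hTs : swallowingTime W z = s) (hseg : ∀ r ∈ Ioc (0 : ℝ) 1, z + r * (p - z) ∈ domain W s) :
    Tendsto (fun r : ℝ ↦ map W s (z + r * (p - z))) (𝓝[>] 0) (𝓝 (W s : ℂ)) := by
  have hz0 : z ≠ W 0 := fun h ↦ by simp [h] at hz
  have hspos : (0 : WithTop ℝ≥0) < s := by
    have := swallowingTime_pos_holds hW hz0
    rwa [hTs] at this
  have hs' : (0 : ℝ≥0) < s := WithTop.coe_pos.1 hspos
  have hs : (0 : ℝ) < s := hs'
  obtain ⟨G, hG⟩ := exists_isSolution_swallowingTime_holds hW hz0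
  have hGs : IsSolution W z G s := by rwa [hTs] at hG
  by_contra hnot
  -- an `ε > 0` with frequently `ε ≤ |gₛ(η r) - W s|` as `r ↓ 0`
  obtain ⟨ε, hε, hfreq⟩ : ∃ ε : ℝ, 0 < ε ∧ ∃ᶠ r : ℝ in 𝓝[>] 0,
      ε ≤ dist (map W s (z + (r : ℂ) * (p - z))) (W s : ℂ) := by
    rw [Metric.tendsto_nhds] at hnot
    simp only [not_forall, exists_prop] at hnot
    obtain ⟨ε, hε, h⟩ := hnot
    exact ⟨ε, hε, (Filter.not_eventually.1 h).mono fun r hr ↦ not_lt.1 hr⟩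
  set θ : ℝ := ε / 2 with hθ
  have hθ0 : 0 < θ := by positivity
  obtain ⟨τW, hτW, hmod⟩ := exists_forall_abs_sub_driving_le hW s (η := θ / 4) (by positivity)
  set τ : ℝ := min τW (min (θ ^ 2 / 4) (s / 2)) with hτ
  have hτ0 : 0 < τ := lt_min hτW (lt_min (by positivity) (by positivity))
  have hττW : τ ≤ τW := min_le_left _ _
  have hτθ : τ ≤ θ ^ 2 / 4 := (min_le_right _ _).trans (min_le_left _ _)
  have hτs : τ ≤ s / 2 := (min_le_right _ _).trans (min_le_right _ _)
  have hmod' : ∀ u ∈ Icc (0 : ℝ) s, ∀ v ∈ Icc (0 : ℝ) s, |u - v| ≤ τ →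
      |W u.toNNReal - W v.toNNReal| ≤ θ / 4 :=
    fun u hu v hv huv ↦ hmod u hu v hv (huv.trans hττW)
  -- Step 1: on `[s - τ, s)` the orbit of `z` is `θ`-away from `W`
  have hnear : ∀ u ∈ Ico ((s : ℝ) - τ) s, θ ≤ ‖G u - W u.toNNReal‖ := by
    intro u hu
    have hu0 : 0 ≤ u := by linarith [hu.1]
    set u' : ℝ≥0 := u.toNNReal with hu'
    have hu'u : (u' : ℝ) = u := Real.coe_toNNReal _ hu0
    have hu's : u' < s := by rw [← NNReal.coe_lt_coe, hu'u]; exact hu.2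
    have hu'T : (u' : WithTop ℝ≥0) < swallowingTime W z := by
      rw [hTs]; exact WithTop.coe_lt_coe.2 hu's
    -- continuity of `g_{u'}` at `z` along the segment
    have hcont : Tendsto (fun r : ℝ ↦ map W u' (z + r * (p - z))) (𝓝[>] 0)
        (𝓝 (map W u' z)) := by
      have h1 : Tendsto (fun r : ℝ ↦ z + r * (p - z)) (𝓝[>] 0) (𝓝 z) := by
        have hc : Continuous fun r : ℝ ↦ z + r * (p - z) := by fun_prop
        simpa using (hc.tendsto 0).mono_left nhdsWithin_le_nhds
      exact (continuousAt_map hW hu'T).tendsto.comp h1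
    -- frequently along `r ↓ 0`: `θ ≤ |g_{u'}(η r) - W u'|` (backward stability from time `s`)
    have hfreq' : ∃ᶠ r : ℝ in 𝓝[>] 0, map W u' (z + (r : ℂ) * (p - z)) ∈
        {w : ℂ | θ ≤ ‖w - W u'‖} := by
      have hev : ∀ᶠ r in 𝓝[>] (0 : ℝ), r ∈ Ioc (0 : ℝ) 1 := Ioc_mem_nhdsGT one_pos
      refine (hfreq.and_eventually hev).mono fun r ⟨hr, hr1⟩ ↦ ?_
      set q := z + r * (p - z) with hq
      have hqs : q ∈ domain W s := hseg r hr1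
      rw [mem_domain_iff] at hqs
      obtain ⟨Q, hQ⟩ :=
        exists_isSolution_swallowingTime_holds hW (ne_driving_of_lt_swallowingTime hqs.2)
      have hsT : ((s : ℝ).toNNReal : WithTop ℝ≥0) < swallowingTime W q := by
        rw [Real.toNNReal_coe]; exact hqs.2
      have hend : 2 * θ ≤ ‖Q s - W (s : ℝ).toNNReal‖ := by
        rw [Real.toNNReal_coe, ← map_eq_of_isSolution hW hQ hqs.2]
        rw [dist_eq_norm] at hr
        linarith
      have hbs := hQ.le_norm_sub_driving_of_end hW hθ0 hτ0 (by linarith) hτθ hsT hmod' hend u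
        ⟨hu.1, hu.2.le⟩
      have hu'Tq : (u' : WithTop ℝ≥0) < swallowingTime W q :=
        lt_trans (WithTop.coe_lt_coe.2 hu's) hqs.2
      change θ ≤ ‖map W u' q - W u'‖
      rw [map_eq_of_isSolution hW hQ hu'Tq, hu'u]
      rwa [← hu'] at hbs
    have hclosed : IsClosed {w : ℂ | θ ≤ ‖w - W u'‖} :=
      isClosed_le continuous_const (continuous_norm.comp (continuous_id.sub continuous_const))
    have hmem := hclosed.mem_of_frequently_of_tendsto hfreq' hcont
    change θ ≤ ‖map W u' z - W u'‖ at hmem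
    rw [map_eq_of_isSolution hW hGs (WithTop.coe_lt_coe.2 hu's), hu'u] at hmem
    exact hmem
  -- Step 2: on `[0, s - τ]` it is `δ`-away
  have hbT : ((((s : ℝ) - τ).toNNReal : ℝ≥0) : WithTop ℝ≥0) < (s : WithTop ℝ≥0) := by
    rw [WithTop.coe_lt_coe, ← NNReal.coe_lt_coe, Real.coe_toNNReal _ (by linarith)]
    linarith
  obtain ⟨δ, hδ, hfar⟩ := hGs.exists_le_norm_sub hW (b := s - τ) (by linarith) hbT
  have hδ' : (0 : ℝ) < δ := hδ
  -- Step 3: contradiction with `inf_{u < s} |G u - W u| = 0`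
  obtain ⟨t₀, ht₀, ht₀s, hlt⟩ := hGs.exists_norm_sub_lt hW hs' hTs (δ := min δ θ)
    (lt_min hδ' hθ0)
  rcases le_or_gt t₀ ((s : ℝ) - τ) with h | h
  · have := hfar t₀ ⟨ht₀, h⟩
    linarith [min_le_left (δ : ℝ) θ]
  · have := hnear t₀ ⟨h.le, ht₀s⟩
    linarith [min_le_right (δ : ℝ) θ]

/-! ### 3. Accessible points lie on the curve -/

/-- **Limits of a conformal map of `ℍₒ` into `ℍₒ` along two curves ending at the same real
point agree** — the half-plane form of `Literature.Analysis.Complex.LengthArea.eq_of_tendsto_of_tendsto`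
(Lindelöf–Koebe; Pommerenke (1992), Cor. 2.17 (i)), obtained by transporting to the disc with
the Cayley transform and making the image bounded with `w ↦ (w + i)⁻¹`. This is "[Ahl73, Th. 3.5]:
the conformal map `gₜ⁻¹` of `ℍ` cannot have two different limits along two arcs with the same
terminal point" in Rohde–Schramm (2005), proof of Thm. 4.1. [cite: PommerenkeBBCM1992, Cor. 2.17 (i)] -/
theorem eq_of_tendsto_of_tendsto_upperHalfPlane {f : ℂ → ℂ}
    (hf : DifferentiableOn ℂ f upperHalfPlaneSet) (hinj : InjOn f upperHalfPlaneSet)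
    (hmaps : MapsTo f upperHalfPlaneSet upperHalfPlaneSet) {x : ℝ} {c₁ c₂ : ℝ → ℂ} {a₁ a₂ : ℂ}
    (hc₁ : ContinuousOn c₁ (Ioc 0 1)) (hm₁ : MapsTo c₁ (Ioc 0 1) upperHalfPlaneSet)
    (hl₁ : Tendsto c₁ (𝓝[>] 0) (𝓝 (x : ℂ))) (ha₁ : Tendsto (fun s ↦ f (c₁ s)) (𝓝[>] 0) (𝓝 a₁))
    (hc₂ : ContinuousOn c₂ (Ioc 0 1)) (hm₂ : MapsTo c₂ (Ioc 0 1) upperHalfPlaneSet)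
    (hl₂ : Tendsto c₂ (𝓝[>] 0) (𝓝 (x : ℂ))) (ha₂ : Tendsto (fun s ↦ f (c₂ s)) (𝓝[>] 0) (𝓝 a₂)) :
    a₁ = a₂ := by
  -- transport to the disc: `F = j ∘ f ∘ cayley⁻¹`, `j w = (w + i)⁻¹`
  set F : ℂ → ℂ := fun w ↦ (f (cayleyInvFun w) + I)⁻¹ with hF
  set ζ : ℂ := cayleyFun x with hζ
  have hζ1 : ‖ζ‖ = 1 := norm_cayleyFun_ofReal x
  have hball_ne : ∀ w ∈ ball (0 : ℂ) 1, w ≠ 1 := fun w hw h1 ↦ by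
    rw [h1, mem_ball_zero_iff, norm_one] at hw; exact lt_irrefl _ hw
  have hφH : MapsTo cayleyInvFun (ball (0 : ℂ) 1) upperHalfPlaneSet := fun w hw ↦
    cayleyInvFun_im_pos (mem_ball_zero_iff.1 hw)
  have hHne : ∀ w ∈ upperHalfPlaneSet, w + I ≠ 0 := fun w hw ↦
    add_I_ne_zero (le_of_lt (show 0 < w.im from hw))
  have hFd : DifferentiableOn ℂ F (ball 0 1) := by
    have h1 : DifferentiableOn ℂ (fun w ↦ f (cayleyInvFun w) + I) (ball 0 1) :=
      (hf.comp (differentiableOn_cayleyInvFun.mono hball_ne) hφH).add_const I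
    exact h1.inv fun w hw ↦ hHne _ (hmaps (hφH hw))
  have hFinj : InjOn F (ball 0 1) := by
    intro w₁ hw₁ w₂ hw₂ heq
    have h1 : f (cayleyInvFun w₁) = f (cayleyInvFun w₂) := add_right_cancel (inv_inj.1 heq)
    have h2 : cayleyInvFun w₁ = cayleyInvFun w₂ := hinj (hφH hw₁) (hφH hw₂) h1
    have := congrArg cayleyFun h2
    rwa [cayleyFun_cayleyInvFun (hball_ne w₁ hw₁), cayleyFun_cayleyInvFun (hball_ne w₂ hw₂)]
      at this
  have hFA : volume (F '' ball 0 1) ≠ ⊤ := by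
    refine ((isBounded_closedBall (x := (0 : ℂ)) (r := 1)).subset ?_).measure_lt_top.ne
    rintro _ ⟨w, hw, rfl⟩
    exact mem_closedBall_zero_iff.2 (norm_inv_add_I_le (le_of_lt (hmaps (hφH hw))))
  -- the transported curves
  have hxI : (x : ℂ) + I ≠ 0 := add_I_ne_zero (by simp)
  have hopen : IsOpen {z : ℂ | z + I ≠ 0} := isOpen_ne_fun (by fun_prop) (by fun_prop)
  have hψx : Tendsto cayleyFun (𝓝 (x : ℂ)) (𝓝 ζ) :=
    (continuousOn_cayleyFun.continuousAt (hopen.mem_nhds hxI)).tendsto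
  have hcurve : ∀ {c : ℝ → ℂ} {a : ℂ}, ContinuousOn c (Ioc 0 1) →
      MapsTo c (Ioc 0 1) upperHalfPlaneSet → Tendsto c (𝓝[>] 0) (𝓝 (x : ℂ)) →
      Tendsto (fun s ↦ f (c s)) (𝓝[>] 0) (𝓝 a) →
      ContinuousOn (fun s ↦ cayleyFun (c s)) (Ioc 0 1) ∧
      MapsTo (fun s ↦ cayleyFun (c s)) (Ioc 0 1) (ball 0 1) ∧
      Tendsto (fun s ↦ cayleyFun (c s)) (𝓝[>] 0) (𝓝 ζ) ∧
      Tendsto (fun s ↦ F (cayleyFun (c s))) (𝓝[>] 0) (𝓝 ((a + I)⁻¹)) := by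
    intro c a hc hm hl ha
    refine ⟨continuousOn_cayleyFun.comp hc fun s hs ↦ hHne _ (hm hs), fun s hs ↦ ?_,
      hψx.comp hl, ?_⟩
    · exact mem_ball_zero_iff.2 ((norm_cayleyFun_lt_one_iff (hHne _ (hm hs))).2 (hm hs))
    · have ha0 : 0 ≤ a.im := by
        refine ge_of_tendsto (Complex.continuous_im.continuousAt.tendsto.comp ha) ?_
        filter_upwards [Ioc_mem_nhdsGT one_pos] with s hs
        exact (show 0 < (f (c s)).im from hmaps (hm hs)).le
      have hj : Tendsto (fun w : ℂ ↦ (w + I)⁻¹) (𝓝 a) (𝓝 ((a + I)⁻¹)) :=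
        ((continuous_id.add continuous_const).tendsto a).inv₀ (add_I_ne_zero ha0)
      refine (hj.comp ha).congr' ?_
      filter_upwards [Ioc_mem_nhdsGT one_pos] with s hs
      simp only [Function.comp_apply, hF]
      rw [cayleyInvFun_cayleyFun (hHne _ (hm hs))]
  obtain ⟨hd₁, hdm₁, hdl₁, hda₁⟩ := hcurve hc₁ hm₁ hl₁ ha₁
  obtain ⟨hd₂, hdm₂, hdl₂, hda₂⟩ := hcurve hc₂ hm₂ hl₂ ha₂
  have := Literature.Analysis.Complex.LengthArea.eq_of_tendsto_of_tendsto hFd hFinj hFA hζ1 hd₁ hdm₁ hdl₁ hda₁ hd₂ hdm₂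
    hdl₂ hda₂
  exact add_right_cancel (inv_inj.1 this)

/-- **Accessible points are on the curve** (Rohde–Schramm (2005), proof of Thm. 4.1, eq. (4.1)
"`β(t') = p'`"; Lawler (2005), proof of Prop. 4.29: "`γ(t)` is the only possible `t`-accessible
point"). Let `W` be continuous and suppose `fₜ(W(t) + iy) → β(t)` as `y ↓ 0` for every `t`. If
`z ∈ ℍₒ` is swallowed exactly at time `s` and the segment `(z, p]` lies in `Hₛ`, then
`z = β(s)`: `fₛ` tends to `β(s)` along the vertical segment at `W(s)` and to `z` along the arc
`gₛ((z, p])`, which ends at `W(s)` by `tendsto_map_of_accessible`.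
[cite: RohdeSchramm2005, proof of Thm 4.1] -/
theorem eq_of_accessible (hW : Continuous W) {β : ℝ≥0 → ℂ}
    (hlim : ∀ t : ℝ≥0, Tendsto (fun y : ℝ ↦ Function.invFunOn (map W t) (domain W t)
      ((W t : ℂ) + I * y)) (𝓝[>] 0) (𝓝 (β t)))
    {z p : ℂ} {s : ℝ≥0} (hz : 0 < z.im) (hTs : swallowingTime W z = s)
    (hseg : ∀ r ∈ Ioc (0 : ℝ) 1, z + r * (p - z) ∈ domain W s) : z = β s := by
  have hbij := bijOn_invFunOn_map hW s
  have h1 : Tendsto (fun r : ℝ ↦ z + r * (p - z)) (𝓝[>] 0) (𝓝 z) := by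
    have hc : Continuous fun r : ℝ ↦ z + r * (p - z) := by fun_prop
    simpa using (hc.tendsto 0).mono_left nhdsWithin_le_nhds
  symm
  refine eq_of_tendsto_of_tendsto_upperHalfPlane (differentiableOn_invFunOn_map hW s) hbij.injOn
    (hbij.mapsTo.mono_right (domain_subset W s)) (x := W s)
    (c₁ := fun y : ℝ ↦ (W s : ℂ) + I * y) (c₂ := fun r : ℝ ↦ map W s (z + r * (p - z)))
    (by fun_prop) (fun y hy ↦ ?_) ?_ (hlim s) ?_ (fun r hr ↦ mapsTo_map hW s (hseg r hr))
    (tendsto_map_of_accessible hW hz hTs hseg) ?_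
  · change 0 < ((W s : ℂ) + I * y).im
    simpa using hy.1
  · have hc : Continuous fun y : ℝ ↦ (W s : ℂ) + I * y := by fun_prop
    simpa using (hc.tendsto 0).mono_left nhdsWithin_le_nhds
  · refine ContinuousOn.comp (g := map W s) (t := domain W s) (fun q hq ↦ ?_) (by fun_prop)
      fun r hr ↦ hseg r hr
    exact (continuousAt_map hW ((mem_domain_iff W s q).1 hq).2).continuousWithinAt
  · refine h1.congr' ?_
    filter_upwards [Ioc_mem_nhdsGT one_pos] with r hr
    exact ((bijOn_map hW s).invOn_invFunOn.1 (hseg r hr)).symm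

/-! ### 4. The boundary of `Hₜ` in `ℍₒ` lies on the curve -/

/-- The boundary value `β(t) = lim_{y↓0} fₜ(W(t) + iy)` is not in `Hₜ` (else, applying the
continuous `gₜ`, `W(t) + iy → gₜ(β(t)) ∈ ℍₒ`, but the limit `W(t)` is real). [folklore] -/
theorem notMem_domain_of_tendsto_invFunOn_map (hW : Continuous W) {t : ℝ≥0} {b : ℂ}
    (h : Tendsto (fun y : ℝ ↦ Function.invFunOn (map W t) (domain W t) ((W t : ℂ) + I * y))
      (𝓝[>] 0) (𝓝 b)) : b ∉ domain W t := by
  intro hb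
  have hbT := ((mem_domain_iff W t b).1 hb).2
  have hg : Tendsto (fun y : ℝ ↦ map W t (Function.invFunOn (map W t) (domain W t)
      ((W t : ℂ) + I * y))) (𝓝[>] 0) (𝓝 (map W t b)) :=
    (continuousAt_map hW hbT).tendsto.comp h
  have hid : Tendsto (fun y : ℝ ↦ (W t : ℂ) + I * y) (𝓝[>] 0) (𝓝 (map W t b)) := by
    refine hg.congr' ?_
    filter_upwards [self_mem_nhdsWithin] with y hy
    have hw : ((W t : ℂ) + I * y) ∈ upperHalfPlaneSet := by
      change 0 < ((W t : ℂ) + I * y).im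
      simpa using hy
    exact (bijOn_map hW t).invOn_invFunOn.2 hw
  have h0 : Tendsto (fun y : ℝ ↦ (W t : ℂ) + I * y) (𝓝[>] 0) (𝓝 ((W t : ℂ) + I * (0 : ℝ))) :=
    ((by fun_prop : Continuous fun y : ℝ ↦ (W t : ℂ) + I * y).tendsto 0).mono_left
      nhdsWithin_le_nhds
  have heq := tendsto_nhds_unique hid h0
  have him : 0 < (map W t b).im := mapsTo_map hW t hb
  rw [heq] at him
  simp at him

/-- **`∂Hₜ ∩ ℍₒ ⊆ β[0, t]`** (Lawler (2005), Prop. 4.27, second part, and proof of Prop. 4.29;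
Rohde–Schramm (2005), proof of Thm. 4.1: "`∂Hₜ ∩ ℍ` is contained in `⋃_{τ≤t} S(τ)`"). Under the
hypothesis of Thm. 4.1: for `w ∈ ∂Hₜ ∩ ℍₒ` and `w' ∈ Hₜ` close to `w`, the first point `z'`
of the segment from `w'` to `w` outside `Hₜ` is swallowed at a time `s ≤ t` and accessible
from `Hₜ ⊆ Hₛ` along the segment, so `z' = β(s)` (`eq_of_accessible`); and `z'` is as close
to `w` as `w'`. [cite: Lawler2005, Prop. 4.27] -/
theorem frontier_domain_subset_image (hW : Continuous W) {β : ℝ≥0 → ℂ} (hβ : Continuous β)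
    (hlim : ∀ t : ℝ≥0, Tendsto (fun y : ℝ ↦ Function.invFunOn (map W t) (domain W t)
      ((W t : ℂ) + I * y)) (𝓝[>] 0) (𝓝 (β t))) (t : ℝ≥0) :
    frontier (domain W t) ∩ upperHalfPlaneSet ⊆ β '' Icc 0 t := by
  rintro w ⟨hwfr, hw⟩
  have hw0 : 0 < w.im := hw
  have hopen := isOpen_domain hW t
  rw [hopen.frontier_eq] at hwfr
  obtain ⟨hwcl, hwH⟩ := hwfr
  have hclosed : IsClosed (β '' Icc 0 t) := (isCompact_Icc.image hβ).isClosed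
  rw [← hclosed.closure_eq, Metric.mem_closure_iff]
  intro δ hδ
  -- a point `w' ∈ Hₜ` within `δ' = min δ (im w / 2)` of `w`
  set δ' : ℝ := min δ (w.im / 2) with hδ'
  have hδ'0 : 0 < δ' := lt_min hδ (by positivity)
  obtain ⟨w', hw'H, hww'⟩ := Metric.mem_closure_iff.1 hwcl δ' hδ'0
  -- the segment `σ l = w' + l (w - w')` and the first parameter at which it leaves `Hₜ`
  set σ : ℝ → ℂ := fun l ↦ w' + l * (w - w') with hσ
  have hσc : Continuous σ := by fun_prop
  set A : Set ℝ := Icc 0 1 ∩ σ ⁻¹' (domain W t)ᶜ with hA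
  have hAc : IsClosed A := isClosed_Icc.inter (hopen.isClosed_compl.preimage hσc)
  have hσ1 : σ 1 = w := by simp [hσ]
  have hσ0 : σ 0 = w' := by simp [hσ]
  have h1A : (1 : ℝ) ∈ A := ⟨⟨zero_le_one, le_rfl⟩, by rw [mem_preimage, hσ1]; exact hwH⟩
  have hAne : A.Nonempty := ⟨1, h1A⟩
  have hAbdd : BddBelow A := ⟨0, fun l hl ↦ hl.1.1⟩
  set l₀ := sInf A with hl₀
  have hl₀A : l₀ ∈ A := hAc.csInf_mem hAne hAbdd
  have hl₀1 : l₀ ≤ 1 := csInf_le hAbdd h1A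
  have hl₀0 : 0 ≤ l₀ := hl₀A.1.1
  have h0A : (0 : ℝ) ∉ A := fun h ↦ h.2 (by rw [hσ0]; exact hw'H)
  have hl₀pos : 0 < l₀ := lt_of_le_of_ne hl₀0 fun h ↦ h0A (h ▸ hl₀A)
  have hbefore : ∀ l ∈ Ico 0 l₀, σ l ∈ domain W t := fun l hl ↦ by
    by_contra hnot
    have hlA : l ∈ A := ⟨⟨hl.1, hl.2.le.trans hl₀1⟩, hnot⟩
    exact absurd (csInf_le hAbdd hlA) (not_le.2 hl.2)
  set z' := σ l₀ with hz'
  -- `z' ∈ ℍₒ ∖ Hₜ` is swallowed at a time `s ≤ t`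
  have hww'n : ‖w - w'‖ < δ' := by rwa [dist_eq_norm] at hww'
  have hw'im : w.im / 2 < w'.im := by
    have h1 : |(w - w').im| ≤ ‖w - w'‖ := Complex.abs_im_le_norm _
    have h2 : ‖w - w'‖ < w.im / 2 := hww'n.trans_le (min_le_right _ _)
    rw [Complex.sub_im] at h1
    linarith [(abs_le.1 h1).1, (abs_le.1 h1).2, le_abs_self (w.im - w'.im)]
  have hz'im : 0 < z'.im := by
    have : z'.im = (1 - l₀) * w'.im + l₀ * w.im := by
      simp only [hz', hσ, Complex.add_im, Complex.mul_im, Complex.ofReal_re, Complex.ofReal_im,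
        Complex.sub_im, zero_mul, add_zero]
      ring
    rw [this]
    nlinarith
  have hz'H : z' ∉ domain W t := hl₀A.2
  have hz'T : swallowingTime W z' ≤ t := by
    by_contra h
    exact hz'H ((mem_domain_iff W t z').2 ⟨hz'im, not_le.1 h⟩)
  obtain ⟨s, hs⟩ := WithTop.ne_top_iff_exists.1 (ne_top_of_le_ne_top WithTop.coe_ne_top hz'T)
  have hst : s ≤ t := by rw [← WithTop.coe_le_coe, hs]; exact hz'T
  -- access segment from `z'` back to `w'`: `z' + r (w' - z') = σ (l₀ (1 - r)) ∈ Hₜ ⊆ Hₛ`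
  have hseg : ∀ r ∈ Ioc (0 : ℝ) 1, z' + r * (w' - z') ∈ domain W s := fun r hr ↦ by
    have heq : z' + r * (w' - z') = σ (l₀ * (1 - r)) := by
      simp only [hz', hσ]; push_cast; ring
    rw [heq]
    refine domain_antitone W hst (hbefore _ ⟨by nlinarith [hr.2, hl₀0], ?_⟩)
    nlinarith [hr.1, hl₀pos]
  have hzβ : z' = β s := eq_of_accessible hW hlim hz'im hs.symm hseg
  refine ⟨z', ⟨s, ⟨zero_le, hst⟩, hzβ.symm⟩, ?_⟩
  -- `dist w z' = (1 - l₀) ‖w - w'‖ < δ`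
  have heq : w - z' = ((1 - l₀ : ℝ) : ℂ) * (w - w') := by simp only [hz', hσ]; push_cast; ring
  rw [dist_eq_norm, heq, norm_mul, Complex.norm_real, Real.norm_eq_abs,
    abs_of_nonneg (by linarith)]
  calc (1 - l₀) * ‖w - w'‖ ≤ 1 * ‖w - w'‖ := by gcongr; linarith
    _ < δ' := by rw [one_mul]; exact hww'n
    _ ≤ δ := min_le_left _ _

/-! ### 5. Unboundedness and connectedness of `Hₜ` -/

/-- `Hₜ` is unbounded: it contains the points of `ℍₒ` far from `W 0` (`mem_domain_of_far`).
[folklore] -/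
theorem not_isBounded_domain (hW : Continuous W) (t : ℝ≥0) : ¬ Bornology.IsBounded (domain W t) := by
  intro hb
  obtain ⟨R, hR⟩ := hb.subset_closedBall 0
  obtain ⟨M, hM0, hM⟩ := exists_forall_norm_driving_sub_le hW t (W 0)
  set δ : ℝ := 2 * Real.sqrt t + 1 with hδ
  have hδ0 : 0 < δ := by positivity
  have hδt : 4 * (t : ℝ) ≤ δ ^ 2 := by
    have h1 : Real.sqrt t ^ 2 = t := Real.sq_sqrt t.coe_nonneg
    nlinarith [Real.sqrt_nonneg (t : ℝ)]
  set y : ℝ := M + 2 * δ + |R| + ‖(W 0 : ℂ)‖ + 1 with hy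
  have hy0 : 0 < y := by positivity
  set q : ℂ := (W 0 : ℂ) + I * y with hq
  have hqH : q ∈ upperHalfPlaneSet := by
    change 0 < q.im
    simpa [hq] using hy0
  have hqy : q - W 0 = I * y := by simp [hq]
  have hnorm : ‖q - W 0‖ = y := by
    rw [hqy, norm_mul, Complex.norm_I, one_mul, Complex.norm_real, Real.norm_eq_abs,
      abs_of_pos hy0]
  have hfar : M + 2 * δ ≤ ‖q - W 0‖ := by rw [hnorm, hy]; linarith [abs_nonneg R, norm_nonneg (W 0 : ℂ)]
  have hqdom : q ∈ domain W t := mem_domain_of_far hW hM hδ0 hδt hqH hfar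
  have h1 : ‖q‖ ≤ R := mem_closedBall_zero_iff.1 (hR hqdom)
  have h2 : y - ‖(W 0 : ℂ)‖ ≤ ‖q‖ := by
    have := norm_sub_norm_le (q - W 0) (-(W 0 : ℂ))
    rw [sub_neg_eq_add, sub_add_cancel, norm_neg, hnorm] at this
    linarith
  linarith [le_abs_self R]

/-- `Hₜ = fₜ(ℍₒ)` is connected. [folklore] -/
theorem isPreconnected_domain (hW : Continuous W) (t : ℝ≥0) : IsPreconnected (domain W t) := by
  rw [← (bijOn_invFunOn_map hW t).image_eq]
  exact (convex_halfSpace_im_gt 0).isPreconnected.image _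
    (differentiableOn_invFunOn_map hW t).continuousOn

end Loewner

/-! ### Theorem 4.1 -/

/-- **`Literature.Probability.RandomPlanarGeometry.RohdeSchramm2005_thm41` holds: Rohde–Schramm (2005), Theorem 4.1** (the deterministic
criterion for Loewner hulls to be generated by a path: if `β(t) = lim_{y↓0} gₜ⁻¹(ξ(t) + iy)`
exists for all `t` and is continuous then `Kₜ = ℍₒ ∖ (unbounded component of ℍₒ ∖ β[0, t])`).
Proof as in the source (p. 899, last paragraph): `Hₜ` is connected, unbounded, disjoint from
`β[0, t]` and its boundary in `ℍₒ` lies on `β[0, t]` (`Loewner.frontier_domain_subset_image`),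
so it is the unbounded component of `ℍₒ ∖ β[0, t]`. [cite: RohdeSchramm2005, Thm 4.1] -/
theorem RohdeSchramm2005_thm41_holds : RohdeSchramm2005_thm41 := by
  intro ξ β hξ hβ hlim t
  set S : Set ℂ := β '' Icc 0 t with hS
  set H : Set ℂ := Loewner.domain ξ t with hH
  have hScpt : IsCompact S := isCompact_Icc.image hβ
  -- (a) `H ⊆ ℍₒ ∖ S`
  have hHU : H ⊆ upperHalfPlaneSet \ S := by
    intro z hz
    refine ⟨Loewner.domain_subset ξ t hz, ?_⟩
    rintro ⟨s, hs, rfl⟩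
    exact Loewner.notMem_domain_of_tendsto_invFunOn_map hξ (hlim s)
      (Loewner.domain_antitone ξ hs.2 hz)
  -- (b) `H` is connected and unbounded, hence inside the unbounded component `V`
  have hHconn : IsPreconnected H := Loewner.isPreconnected_domain hξ t
  have hHunb : ¬ Bornology.IsBounded H := Loewner.not_isBounded_domain hξ t
  have hHV : H ⊆ Loewner.unboundedComponent (upperHalfPlaneSet \ S) :=
    subset_unboundedComponent_of_isPreconnected hHconn hHU hHunb
  have hHne : H.Nonempty := by
    by_contra h
    rw [not_nonempty_iff_eq_empty] at h
    exact hHunb (h ▸ Bornology.isBounded_empty)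
  -- (c) `V ⊆ H`: `V` is connected and `H` is relatively clopen in `ℍₒ ∖ S`
  have hVconn := isConnected_unboundedComponent (S := S) hScpt.isBounded
  have hfront := Loewner.frontier_domain_subset_image hξ hβ hlim t
  have hopen : IsOpen H := Loewner.isOpen_domain hξ t
  have hVH : Loewner.unboundedComponent (upperHalfPlaneSet \ S) ⊆ H := by
    refine hVconn.isPreconnected.subset_left_of_subset_union hopen isClosed_closure.isOpen_compl
      (disjoint_compl_right.mono_left subset_closure) (fun z hz ↦ ?_) ?_
    · by_cases hzc : z ∈ closure H
      · left
        by_contra hzH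
        have hzfr : z ∈ frontier H := by rw [hopen.frontier_eq]; exact ⟨hzc, hzH⟩
        have hzU := Loewner.unboundedComponent_subset _ hz
        exact hzU.2 (hfront ⟨hzfr, hzU.1⟩)
      · exact Or.inr hzc
    · obtain ⟨z, hz⟩ := hHne
      exact ⟨z, hHV hz, hz⟩
  have hHeq : H = Loewner.unboundedComponent (upperHalfPlaneSet \ S) := hHV.antisymm hVH
  calc Loewner.hull ξ t = upperHalfPlaneSet \ H := by
        rw [hH, Loewner.domain, sdiff_sdiff_cancel_left (Loewner.hull_subset ξ t)]
    _ = upperHalfPlaneSet \ Loewner.unboundedComponent (upperHalfPlaneSet \ β '' Icc 0 t) := by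
        rw [hHeq]

/-! ### Consequences -/

/-- **Theorem 4.1 as a criterion**: for a continuous driving function `W` and a continuous `β`
with `fₜ(W(t) + iy) → β(t)` (`y ↓ 0`) for every `t`, the chain is generated by the curve `β`.
[cite: RohdeSchramm2005, Thm 4.1] -/
theorem Loewner.isGeneratedByCurve_of_tendsto {W : ℝ≥0 → ℝ} {β : ℝ≥0 → ℂ} (hW : Continuous W)
    (hβ : Continuous β)
    (hlim : ∀ t : ℝ≥0, Tendsto (fun y : ℝ ↦ Function.invFunOn (Loewner.map W t)
      (Loewner.domain W t) ((W t : ℂ) + I * y)) (𝓝[>] 0) (𝓝 (β t))) :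
    Loewner.IsGeneratedByCurve W β :=
  Loewner.isGeneratedByCurve_of_thm41 RohdeSchramm2005_thm41_holds hW hβ hlim

/-- **SLE₀ is generated by the curve `t ↦ 2i√t`**, unconditionally
(`Loewner.hasSLETrace_zero_of_thm41` and `RohdeSchramm2005_thm41_holds`). [cite: RohdeSchramm2005, Thm 4.1] -/
theorem hasSLETrace_zero : HasSLETrace 0 :=
  Loewner.hasSLETrace_zero_of_thm41 RohdeSchramm2005_thm41_holds

/-- **Rohde–Schramm (2005), Thm. 5.1 from Thm. 3.6 alone**: the named fact
`hasSLETrace_of_ne_eight` follows from the stochastic estimate `RohdeSchramm2005_thm36`, the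
deterministic criterion Thm. 4.1 being proved (`RohdeSchramm2005_thm41_holds`). [cite: RohdeSchramm2005, Thm 5.1] -/
theorem hasSLETrace_of_ne_eight_of_thm36 (h36 : RohdeSchramm2005_thm36) :
    hasSLETrace_of_ne_eight :=
  hasSLETrace_of_ne_eight_of_RS05 h36 RohdeSchramm2005_thm41_holds

/-- **`exists_isSLECurve` from the three stochastic trace theorems**: Lawler–Schramm–Werner's
`κ = 8` trace theorem (`hasSLETrace_eight`, [LSW04] Thm. 4.7), Rohde–Schramm's derivative
estimate (`RohdeSchramm2005_thm36`, Thm. 3.6) and transience (`tendsto_norm_sleTrace_atTop`,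
Thm. 7.1); everything else (Thm. 4.1, Riemann mapping, Carathéodory, Loewner theory,
measurability of the trace) is proved in the tree (`exists_isSLECurve_of_trace_theorems`).
[cite: RohdeSchramm2005, Thm 5.1] -/
theorem exists_isSLECurve_of_thm36 (h8 : hasSLETrace_eight) (h36 : RohdeSchramm2005_thm36)
    (htr : tendsto_norm_sleTrace_atTop) : exists_isSLECurve :=
  exists_isSLECurve_of_trace_theorems h8 (hasSLETrace_of_ne_eight_of_thm36 h36) htr

end Literature.Probability.RandomPlanarGeometry
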